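import Literature.AlgebraicGeometry.HodgeTheory.GeneralHodgePropertyLevelForm
import HarnessLib

/-!
# Hodge-number bound for Grothendieck's largest sub-Hodge structure and for the coniveau classes:
# `dim max(k, r) ≤ Σ_{p+q=k, p,q ≥ r} h^{p,q}(X)`, `dim Nʳ Hᵏ ≤ Σ_{p,q ≥ r} h^{p,q}(X)`

Family `hodge`, layer `Literature/AlgebraicGeometry/HodgeTheory`; lane `lit-hodgefound` (Track 2 foundations,
Layer A1/A4). THEOREMS ONLY (no definition, no named fact; D-0026).

Grothendieck (Topology 8, 1969, p. 300) observes that `Filt'ᵖ Hⁱ ⊗ ℂ` is a sub-Hodge structure, hence has even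
rank for `i` odd — the parity obstruction behind «Hodge's general conjecture is false for trivial reasons» (the
tree's barrier `Grothendieck1969_rationalSupportedClasses_evenRank`). The same mechanism bounds dimensions:
an admissible subspace `W` of `(Hᵏ, Fʳ)` (rationally spanned, sub-Hodge, inside `Fʳ`; Murre §5.7 b: «level
`≤ n − 2p`») has no type components outside `{(p, q) : p, q ≥ r}` (`IsRationalClass.typeProj_eq_zero_of_mem_hodgeFiltrationBetti`
and rational spanning), so the type projectors embed it into `Π_{p+q=k, p,q ≥ r} H^{p,q}`:

* §1 `HodgeModel.typeProj_eq_zero_of_mem_ratSubHodgeInFilt`, `HodgeModel.eq_sum_typeProj_of_mem_ratSubHodgeInFilt`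
  (`c = Σ_{p,q ≥ r} π_{(p,q)} c` for `c` in an admissible `W`).
* §2 **`HodgeModel.finrank_le_sum_finrank_typePiece_of_mem_ratSubHodgeInFilt`** — `dim_ℂ W ≤ Σ_{p+q=k, p,q ≥ r} dim H^{p,q}_A`
  for every admissible `W`, and its model-free form **`BettiUniverse.finrank_le_sum_hodgeNumber_of_mem_ratSubHodgeInFilt`**
  with the Hodge numbers `h^{p,q}(X) = (BettiUniverse.hodge hHD hX k).hodgeNumber p q`
  (`BettiUniverse.hodgeNumber_hodge_eq_finrank_typePiece`).
* §3 **`BettiUniverse.finrank_maxRatSubHodgeInFilt_le_sum_hodgeNumber`** (`dim max(k, r) ≤ Σ h^{p,q}`) and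
  **`BettiUniverse.finrank_supportedClasses_le_sum_hodgeNumber`** (`dim Nʳ Hᵏ(X(ℂ); ℂ) ≤ Σ_{p+q=k, p,q ≥ r} h^{p,q}(X)`;
  `Nʳ Hᵏ` is admissible — `HodgeModel.supportedClasses_mem_ratSubHodgeInFilt`, Deligne 8.2.8 in the tree).
* §4 **`generalHodgePropertyFor_of_hodgeNumber_eq_zero`** — `GHC(X, k, r)` holds whenever `h^{p,q}(X) = 0` for all
  `p + q = k` with `p, q ≥ r` (then `max(k, r) = 0`: no sub-Hodge structure of that level exists), and
  `maxRatSubHodgeInFilt_eq_bot_of_hodgeNumber_eq_zero`.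

## References

* [GrothendieckTopology1969] A. Grothendieck, Hodge's general conjecture is false for trivial reasons, Topology 8
  (1969), p. 300 (parity of `Filt'`).
* [MurreTorino1994] J. P. Murre, Algebraic cycles and algebraic aspects of cohomology and K-theory (Torino 1993),
  LNM 1594, §5.7 a–b (PDF p. 110: «the LHS, having a Hodge structure, has even dimension»; level `≤ n − 2p`).
* [VoisinHodgeI2002] C. Voisin, Hodge Theory and Complex Algebraic Geometry I, CUP 2002, §6.1.3 Cor. 6.12–6.13,
  §7.1.1, §7.3.1.
* [Voisin2025] C. Voisin, Hodge and generalized Hodge conjectures, coniveau and algebraic cycles, J. Open Math.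
  Probl. 1 (2025), Def. 2.4, §4.1 Cor. 4.5 (ii).
-/

noncomputable section

open CategoryTheory AlgebraicGeometry Module
open Literature.AlgebraicTopology.SingularHomology
open Literature.Geometry.Kaehler
open Literature.AlgebraicGeometry.Motives (IsSmoothProjective ComplexPoints)

namespace Literature.AlgebraicGeometry.HodgeTheory

variable {n : ℕ} {X : Motives.SchemeOver ℂ}

/-! ### §1 Admissible subspaces have no type components outside `p, q ≥ r` -/

/-- **The type components `π_{(p,q)} c`, `p < r` or `q < r`, vanish on an admissible subspace of `(Hᵏ, Fʳ)`**:
`W` is spanned by rational classes of `Fʳ Hᵏ`, whose such components vanish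
(`IsRationalClass.typeProj_eq_zero_of_mem_hodgeFiltrationBetti`), and `π_{(p,q)}` is linear.
[cite: VoisinHodgeI2002, §7.1.1 and Cor. 6.12] [cite: MurreTorino1994, §5.7 b] -/
theorem HodgeModel.typeProj_eq_zero_of_mem_ratSubHodgeInFilt (A : HodgeModel n X) (hX : IsSmoothProjective n X)
    {k r : ℕ} {W : Submodule ℂ (complexBetti X k)} (hW : W ∈ A.ratSubHodgeInFilt k r) {c : complexBetti X k}
    (hc : c ∈ W) (pq : ↥(Finset.HasAntidiagonal.antidiagonal k)) (h : pq.1.1 < r ∨ pq.1.2 < r) :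
    A.typeProj k pq c = 0 := by
  have hle : W ≤ LinearMap.ker (A.typeProj k pq) := by
    refine hW.1.le.trans (Submodule.span_le.2 ?_)
    rintro x ⟨hxW, hx⟩
    exact LinearMap.mem_ker.2 (hx.typeProj_eq_zero_of_mem_hodgeFiltrationBetti hX A (hW.2.2 hxW) pq h)
  exact LinearMap.mem_ker.1 (hle hc)

/-- **An element of an admissible subspace of `(Hᵏ, Fʳ)` is the sum of its type components with `p, q ≥ r`.**
[cite: VoisinHodgeI2002, Thm. 6.18 and §7.1.1] [cite: MurreTorino1994, §5.7 b] -/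
theorem HodgeModel.eq_sum_typeProj_of_mem_ratSubHodgeInFilt (A : HodgeModel n X) (hX : IsSmoothProjective n X)
    {k r : ℕ} {W : Submodule ℂ (complexBetti X k)} (hW : W ∈ A.ratSubHodgeInFilt k r) {c : complexBetti X k}
    (hc : c ∈ W) :
    c = ∑ pq ∈ Finset.univ.filter
      (fun pq : ↥(Finset.HasAntidiagonal.antidiagonal k) ↦ r ≤ pq.1.1 ∧ r ≤ pq.1.2), A.typeProj k pq c := by
  classical
  conv_lhs => rw [← A.sum_typeProj k c]
  rw [← Finset.sum_filter_add_sum_filter_not Finset.univ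
    (fun pq : ↥(Finset.HasAntidiagonal.antidiagonal k) ↦ r ≤ pq.1.1 ∧ r ≤ pq.1.2)]
  rw [Finset.sum_eq_zero (s := Finset.univ.filter
    fun pq : ↥(Finset.HasAntidiagonal.antidiagonal k) ↦ ¬(r ≤ pq.1.1 ∧ r ≤ pq.1.2)) ?_, add_zero]
  intro pq hpq
  rw [Finset.mem_filter] at hpq
  exact A.typeProj_eq_zero_of_mem_ratSubHodgeInFilt hX hW hc pq (by omega)

/-! ### §2 `dim W ≤ Σ_{p+q=k, p,q ≥ r} h^{p,q}` for admissible `W` -/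

/-- **`dim_ℂ W ≤ Σ_{p+q=k, p,q ≥ r} dim_ℂ H^{p,q}_A(X)` for every admissible subspace `W` of `(Hᵏ, Fʳ)`**: the type
projectors `(π_{(p,q)})_{p,q ≥ r}` embed `W` into `Π_{p,q ≥ r} H^{p,q}_A` (§1: an element of `W` is the sum of
these components). [cite: GrothendieckTopology1969, p. 300] [cite: MurreTorino1994, §5.7 a–b]
[cite: VoisinHodgeI2002, §7.1.1 and Cor. 6.12–6.13] -/
theorem HodgeModel.finrank_le_sum_finrank_typePiece_of_mem_ratSubHodgeInFilt (A : HodgeModel n X)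
    (hX : IsSmoothProjective n X) {k r : ℕ} {W : Submodule ℂ (complexBetti X k)}
    (hW : W ∈ A.ratSubHodgeInFilt k r) :
    finrank ℂ W ≤ ∑ pq ∈ Finset.univ.filter
      (fun pq : ↥(Finset.HasAntidiagonal.antidiagonal k) ↦ r ≤ pq.1.1 ∧ r ≤ pq.1.2),
        finrank ℂ (A.typePiece k pq) := by
  classical
  haveI := finite_complexBetti hX k
  set S := Finset.univ.filter
    (fun pq : ↥(Finset.HasAntidiagonal.antidiagonal k) ↦ r ≤ pq.1.1 ∧ r ≤ pq.1.2) with hS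
  -- the type projectors with `p, q ≥ r`, restricted to `W`
  let f : W →ₗ[ℂ] (∀ pq : ↥S, A.typePiece k pq.1) :=
    LinearMap.pi fun pq ↦ ((A.typeProj k pq.1).codRestrict (A.typePiece k pq.1) (A.typeProj_mem k pq.1)) ∘ₗ
      W.subtype
  have hf : Function.Injective f := by
    intro x y hxy
    apply Subtype.ext
    rw [A.eq_sum_typeProj_of_mem_ratSubHodgeInFilt hX hW x.2, A.eq_sum_typeProj_of_mem_ratSubHodgeInFilt hX hW y.2]
    refine Finset.sum_congr rfl fun pq hpq ↦ ?_
    have h := congrArg (fun g ↦ ((g ⟨pq, hpq⟩ : A.typePiece k pq) : complexBetti X k)) hxy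
    simpa [f] using h
  calc finrank ℂ W ≤ finrank ℂ (∀ pq : ↥S, A.typePiece k pq.1) := LinearMap.finrank_le_finrank_of_injective hf
    _ = ∑ pq : ↥S, finrank ℂ (A.typePiece k pq.1) := Module.finrank_pi_fintype ℂ
    _ = ∑ pq ∈ S, finrank ℂ (A.typePiece k pq) := Finset.sum_coe_sort S fun pq ↦ finrank ℂ (A.typePiece k pq)

/-- **MODEL-FREE: `dim_ℂ W ≤ Σ_{p+q=k, p,q ≥ r} h^{p,q}(X)`** for every admissible subspace `W` of `(Hᵏ, Fʳ)`, with
the Hodge numbers of the Betti universe (`BettiUniverse.hodgeNumber_hodge_eq_finrank_typePiece`: they are the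
dimensions of the type pieces of any Hodge model). [cite: GrothendieckTopology1969, p. 300]
[cite: MurreTorino1994, §5.7 a–b] [cite: VoisinHodgeI2002, §6.1.3 Cor. 6.12–6.13] -/
theorem BettiUniverse.finrank_le_sum_hodgeNumber_of_mem_ratSubHodgeInFilt (hHD : exists_isReal_hodgeModel)
    (hX : IsSmoothProjective n X) (A : HodgeModel n X) {k r : ℕ} {W : Submodule ℂ (complexBetti X k)}
    (hW : W ∈ A.ratSubHodgeInFilt k r) :
    finrank ℂ W ≤ ∑ pq ∈ Finset.univ.filter
      (fun pq : ↥(Finset.HasAntidiagonal.antidiagonal k) ↦ r ≤ pq.1.1 ∧ r ≤ pq.1.2),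
        (BettiUniverse.hodge hHD hX k).hodgeNumber pq.1.1 pq.1.2 := by
  refine (A.finrank_le_sum_finrank_typePiece_of_mem_ratSubHodgeInFilt hX hW).trans_eq
    (Finset.sum_congr rfl fun pq _ ↦ ?_)
  rw [BettiUniverse.hodgeNumber_hodge_eq_finrank_typePiece hHD hX A
    (Finset.HasAntidiagonal.mem_antidiagonal.1 pq.2)]

/-! ### §3 `dim max(k, r)` and `dim Nʳ Hᵏ` are bounded by `Σ_{p,q ≥ r} h^{p,q}` -/

/-- **`dim_ℂ max(k, r) ≤ Σ_{p+q=k, p,q ≥ r} h^{p,q}(X)`** — Grothendieck's largest rational sub-Hodge structure in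
`Fʳ Hᵏ` has dimension at most the total Hodge number of level `≤ k − 2r`. [cite: GrothendieckTopology1969, p. 300]
[cite: MurreTorino1994, §5.7 a–b] -/
theorem BettiUniverse.finrank_maxRatSubHodgeInFilt_le_sum_hodgeNumber (hHD : exists_isReal_hodgeModel)
    (hX : IsSmoothProjective n X) (A : HodgeModel n X) (k r : ℕ) :
    finrank ℂ (A.maxRatSubHodgeInFilt k r) ≤ ∑ pq ∈ Finset.univ.filter
      (fun pq : ↥(Finset.HasAntidiagonal.antidiagonal k) ↦ r ≤ pq.1.1 ∧ r ≤ pq.1.2),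
        (BettiUniverse.hodge hHD hX k).hodgeNumber pq.1.1 pq.1.2 :=
  BettiUniverse.finrank_le_sum_hodgeNumber_of_mem_ratSubHodgeInFilt hHD hX A (A.maxRatSubHodgeInFilt_mem k r)

/-- **`dim_ℂ Nʳ Hᵏ(X(ℂ); ℂ) ≤ Σ_{p+q=k, p,q ≥ r} h^{p,q}(X)`**: the classes supported in codimension `≥ r` span a
subspace of dimension at most the total Hodge number of the types `(p, q)`, `p, q ≥ r` (`Nʳ Hᵏ` is admissible —
rationally spanned, sub-Hodge by Deligne's Cor. 8.2.8, inside `Fʳ` — the tree's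
`HodgeModel.supportedClasses_mem_ratSubHodgeInFilt`). The parity refinement for `k` odd is Grothendieck's remark
(the tree's `Grothendieck1969_rationalSupportedClasses_evenRank`). [cite: GrothendieckTopology1969, p. 300]
[cite: MurreTorino1994, §5.7 a] [cite: Voisin2025, §4.1 Cor. 4.5 (ii)] -/
theorem BettiUniverse.finrank_supportedClasses_le_sum_hodgeNumber (hHD : exists_isReal_hodgeModel)
    (hX : IsSmoothProjective n X) (k r : ℕ) :
    finrank ℂ (supportedClasses X k r) ≤ ∑ pq ∈ Finset.univ.filter
      (fun pq : ↥(Finset.HasAntidiagonal.antidiagonal k) ↦ r ≤ pq.1.1 ∧ r ≤ pq.1.2),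
        (BettiUniverse.hodge hHD hX k).hodgeNumber pq.1.1 pq.1.2 := by
  obtain ⟨A⟩ := nonempty_hodgeModel_holds (n := n) (X := X) hX
  exact BettiUniverse.finrank_le_sum_hodgeNumber_of_mem_ratSubHodgeInFilt hHD hX A
    (A.supportedClasses_mem_ratSubHodgeInFilt hX k r)

/-! ### §4 `GHC(X, k, r)` when no Hodge substructure of level `≤ k − 2r` can exist -/

/-- **`max(k, r) = 0` when `h^{p,q}(X) = 0` for all `p + q = k`, `p, q ≥ r`** (its dimension is bounded by the
sum of these Hodge numbers). [cite: GrothendieckTopology1969, p. 300] [cite: MurreTorino1994, §5.7 b] -/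
theorem maxRatSubHodgeInFilt_eq_bot_of_hodgeNumber_eq_zero (hHD : exists_isReal_hodgeModel)
    (hX : IsSmoothProjective n X) (A : HodgeModel n X) {k r : ℕ}
    (h : ∀ p q : ℕ, p + q = k → r ≤ p → r ≤ q → (BettiUniverse.hodge hHD hX k).hodgeNumber p q = 0) :
    A.maxRatSubHodgeInFilt k r = ⊥ := by
  haveI := finite_complexBetti hX k
  refine Submodule.finrank_eq_zero.1 (Nat.le_zero.1 ?_)
  refine (BettiUniverse.finrank_maxRatSubHodgeInFilt_le_sum_hodgeNumber hHD hX A k r).trans_eq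
    (Finset.sum_eq_zero fun pq hpq ↦ ?_)
  rw [Finset.mem_filter] at hpq
  exact h _ _ (Finset.HasAntidiagonal.mem_antidiagonal.1 pq.2) hpq.2.1 hpq.2.2

/-- **`GHC(X, k, r)` holds whenever `h^{p,q}(X) = 0` for all `p + q = k` with `p, q ≥ r`**: then `Fʳ Hᵏ` contains
no non-zero rational sub-Hodge structure, `max(k, r) = 0`, and there is nothing to support (e.g. `GHC(X, k, r)`
for all `k` odd on a variety with all `h^{p,q} = 0`, `p ≠ q`). [cite: GrothendieckTopology1969, p. 300]
[cite: MurreTorino1994, §5.7 b] [cite: Voisin2025, Def. 2.4] -/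
theorem generalHodgePropertyFor_of_hodgeNumber_eq_zero (hHD : exists_isReal_hodgeModel)
    (hX : IsSmoothProjective n X) {k r : ℕ}
    (h : ∀ p q : ℕ, p + q = k → r ≤ p → r ≤ q → (BettiUniverse.hodge hHD hX k).hodgeNumber p q = 0) :
    GeneralHodgePropertyFor n X k r := by
  obtain ⟨A⟩ := nonempty_hodgeModel_holds (n := n) (X := X) hX
  refine (generalHodgePropertyFor_iff_of_hodgeModel A hX k r).2 ?_
  rw [maxRatSubHodgeInFilt_eq_bot_of_hodgeNumber_eq_zero hHD hX A h]
  exact bot_le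

end Literature.AlgebraicGeometry.HodgeTheory

end
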